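import Literature.AnabelianGeometry.EtaleTheta.SettingModelChiMuTwoInversion
import Literature.AnabelianGeometry.EtaleTheta.SettingModelChiInversionTheta
import HarnessLib

/-!
# [EtTh] Prop. 1.8 / Thm. 1.10 at the χ-twisted model, part A: conjugation by `ε_±` on `Π^tp_C = Π^tp_X ⋊_ι ℤ/2` PRESERVES
# THE COVERINGS of Def. 1.7, restricts to the twisted inversion `ι` on `Π^tp_X`, and induces the NON-TRIVIAL inner
# automorphism `γ` of `Π^tp_Ċ` by `ε_±·ε_μ`

S. Mochizuki, *The étale theta function and its Frobenioid-theoretic manifestations*, Publ. RIMS **45** (2009) [EtTh],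
§1: Def. 1.7 p. 27, Prop. 1.8 p. 28 (γ "induces an isomorphism between the commutative diagrams" of the coverings
`Π^tp_Ÿ → Π^tp_Ẍ → Π^tp_Ẋ → Π^tp_X`, `Π^tp_Ċ → Π^tp_C`), Thm. 1.10 pp. 29–30 ("`γ : Π^tp_{Ċα} →̃ Π^tp_{Ċβ}`"); §2 p. 36 (`ι`)
[cite: MochizukiEtTh2009, Prop 1.8 p.28]. Layer L2 of the abc-iut cell, seat abc-iut-w5-d140 (gen 4; K2 holder lineage),
row «K2-NV at a NON-TRIVIAL isomorphism», part A (part B = `Discharge/Sec1Thm110ModelChiInversionNV`: the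
`Thm110Hypothesis` and Thm. 1.10 (i)(ii) for this `γ`). Over this lineage's `SettingModelChiMuTwoInversion` (F8ι:
`MuTwoSetting.inversionModelχ`, `PiCInvχ`, `epsPMInvχ`, `epsZInvχ`, `epsPM_conj_inlχ`, `twistedInversion_mem_Xddχ_iff`),
abc-iut-f-113's `Xddχ` / `mul_self_mem_Xddχ` (F8), abc-iut-L2-d1's `thm16i_twistedInversion_modelχ`
(`SettingModelChiInversionTheta`), abc-iut-L2-t10's `toZ_twistedInversion_modelχ`, abc-iut-w5-d072/L2-t1's `gfpInv` /
`sigmaHat_eta` — consumed BY NAME.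

WHAT (`M := MuTwoSetting.inversionModelχ p`):
* `conjEpsPMχ : Π^tp_C ≃ₜ* Π^tp_C` — conjugation by `ε_±`, an INVOLUTION (`epsPMInvχ_mul_self : ε_±² = 1`) with
  `conjEpsPMχ_inclInvχ : Γ (inclX x) = inclX (ι x)`; `conjEpsPMχ_epsZInvχ : Γ(a) = a⁻¹`, `conjEpsPMχ_epsMu : Γ(ε_μ) = ε_μ⁻¹`
  (`gfpInv_gfpOf_zero : ι_Γ(a) = a⁻¹`);
* **`preservesCoverings_conjEpsPMχ : PreservesCoverings ε_Z ε_Z conjEpsPMχ`** — `Γ(Π^tp_Ÿ) = Π^tp_Ÿ` (Thm. 1.6 (i) for `ι`),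
  `Γ(Π^tp_Ẍ) = Π^tp_Ẍ` (`ι`-stability), `Γ(Π^tp_Ẋ) = Π^tp_Ẋ` (`Π^tp_Ẋ = Π^tp_Ẍ·⟨a⟩`, `Γ(a) = a⁻¹`), `Γ(Π^tp_X) = Π^tp_X`,
  `Γ(Π^tp_Ċ) = Π^tp_Ċ` (`Γ(ε_±ε_μ) = (ε_±ε_μ)·ε_μ⁻²`, `ε_μ² ∈ Π^tp_Ẍ`) — inclusions upgraded to equalities because `Γ² = id`;
* `gammaDotCχ : Π^tp_Ċ ≃ₜ* Π^tp_Ċ`, the inner automorphism by `ε_±·ε_μ ∈ Π^tp_Ċ` — print's `γ` for this instance —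
  and **`gammaDotCχ_ne_refl`**: `γ ≠ id` (it sends `a` to `Γ(b a b⁻¹) = inclX(ι(b a b⁻¹))`, of degree `−1 ≠ 1`).

HONEST FRAMING: SEMI-SYNTHETIC model (the χ-twisted root; not the tempered `π₁` of a curve) — consistency / non-vacuity
evidence for the typed interface ONLY; nothing of [EtTh] is asserted; typed ≠ proved; no side is taken on [IUTchIII]
Cor. 3.12. Definitions (class (b), no instance, no `Prop` fact): `invχ` (abbrev for the twisted inversion), `conjEpsPMχ`,
`gammaDotCχ`.
-/

noncomputable section

namespace Literature.AnabelianGeometry.EtaleTheta.SettingModel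

open Literature.AnabelianGeometry.SemiGraphs Literature.AnabelianGeometry.AbsoluteAnabelian
open _root_.Topology _root_.Function

variable (p : ℕ) [Fact p.Prime]
/-! ### §0. The twisted inversion -/

/-- The twisted inversion of `Π^tp_X = Γ ⋊_χ G_{ℚ_p}` as a topological automorphism (abc-iut-w5-d072 / L2-t1 / w5-d249).
[cite: MochizukiEtTh2009, §2 p.36] -/
abbrev invχ : PiTpχ p ≃ₜ* PiTpχ p := twistedInversionTop (chi p) (isInducing_leftRightχ p)

/-! ### §1. Conjugation by `ε_±` on `Π^tp_C`: an involution restricting to `ι` -/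

/-- `ε_±² = 1` in `Π^tp_X ⋊_ι ℤ/2`. [cite: MochizukiEtTh2009, Def 1.7 p.27] -/
theorem epsPMInvχ_mul_self : epsPMInvχ p * epsPMInvχ p = 1 := by
  rw [epsPMInvχ, ← map_mul]
  have h : Multiplicative.ofAdd (1 : ZMod 2) * Multiplicative.ofAdd 1 = 1 := by decide
  rw [h, map_one]

/-- `ε_±⁻¹ = ε_±`. [cite: MochizukiEtTh2009, Def 1.7 p.27] -/
theorem epsPMInvχ_inv : (epsPMInvχ p)⁻¹ = epsPMInvχ p :=
  inv_eq_of_mul_eq_one_right (epsPMInvχ_mul_self p)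

/-- **`Γ := conj ε_±`, a topological automorphism of `Π^tp_C`** (the extension of γ to `Π^tp_C` of Prop. 1.8). DEFINED.
[cite: MochizukiEtTh2009, Prop 1.8 p.28] -/
def conjEpsPMχ : PiCInvχ p ≃ₜ* PiCInvχ p where
  toMulEquiv := MulAut.conj (epsPMInvχ p)
  continuous_toFun := by
    change Continuous fun x : PiCInvχ p => epsPMInvχ p * x * (epsPMInvχ p)⁻¹
    exact (continuous_const.mul continuous_id).mul continuous_const
  continuous_invFun := by
    change Continuous fun x : PiCInvχ p => (epsPMInvχ p)⁻¹ * x * epsPMInvχ p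
    exact (continuous_const.mul continuous_id).mul continuous_const

/-- [cite: MochizukiEtTh2009, Prop 1.8 p.28] -/
theorem conjEpsPMχ_apply (x : PiCInvχ p) : conjEpsPMχ p x = epsPMInvχ p * x * (epsPMInvχ p)⁻¹ := rfl

/-- **`Γ` restricts to `ι` on `Π^tp_X`**: `Γ (inclX x) = inclX (ι x)`. [cite: MochizukiEtTh2009, Prop 1.8 p.28] -/
theorem conjEpsPMχ_inclInvχ (x : PiTpχ p) : conjEpsPMχ p (inclInvχ p x) = inclInvχ p (invχ p x) :=
  epsPM_conj_inlχ p x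

/-- `Γ` is an involution. [cite: MochizukiEtTh2009, Prop 1.8 p.28] -/
theorem conjEpsPMχ_conjEpsPMχ (x : PiCInvχ p) : conjEpsPMχ p (conjEpsPMχ p x) = x := by
  rw [conjEpsPMχ_apply, conjEpsPMχ_apply, epsPMInvχ_inv]
  have h := epsPMInvχ_mul_self p
  calc epsPMInvχ p * (epsPMInvχ p * x * epsPMInvχ p) * epsPMInvχ p
      = (epsPMInvχ p * epsPMInvχ p) * x * (epsPMInvχ p * epsPMInvχ p) := by group
    _ = x := by rw [h, one_mul, mul_one]

/-- An involutive homomorphism that maps a subgroup INTO itself maps it ONTO itself. [folklore] -/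
private theorem map_eq_of_le_of_involutive {G : Type*} [Group G] (f : G →* G) (hf : ∀ x, f (f x) = x)
    (H : Subgroup G) (h : H.map f ≤ H) : H.map f = H := by
  refine le_antisymm h fun x hx => ?_
  exact ⟨f x, h ⟨x, hx, rfl⟩, hf x⟩

/-! ### §2. `Γ` preserves the coverings of Def. 1.7 -/

/-- `ι(a) = a⁻¹` for the loop `a` of `Γ` (`σ̂(η a) = η(a⁻¹)`, and the degree is negated). [cite: MochizukiEtTh2009, §2 p.36] -/
theorem gfpInv_gfpOf_zero : gfpInv (gfpOf (FreeGroup.of 0)) = (gfpOf (FreeGroup.of 0))⁻¹ := by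
  refine Subtype.ext ?_
  rw [coe_gfpInv, Subgroup.coe_inv]
  change (sigmaHat (eta (FreeGroup.of 0)), (expA (FreeGroup.of 0))⁻¹) =
    ((eta (FreeGroup.of (0 : Fin 2)), expA (FreeGroup.of 0)) : F₂hatT × Multiplicative ℤ)⁻¹
  rw [Prod.inv_mk, sigmaHat_eta, ← map_inv]
  rfl

/-- `Γ (inclX a) = (inclX a)⁻¹`. [cite: MochizukiEtTh2009, Prop 1.8 p.28] -/
theorem conjEpsPMχ_epsZInvχ : conjEpsPMχ p (epsZInvχ p) = (epsZInvχ p)⁻¹ := by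
  rw [epsZInvχ, conjEpsPMχ_inclInvχ, invχ, twistedInversionTop_apply, twistedInversion_inl, gfpInv_gfpOf_zero, map_inv,
    map_inv]

/-- `Γ (ε_μ) = ε_μ⁻¹` (`ε_μ = inclX b`, `ι(b) = b⁻¹`). [cite: MochizukiEtTh2009, Prop 1.8 p.28] -/
theorem conjEpsPMχ_epsMu :
    conjEpsPMχ p (MuTwoSetting.inversionModelχ p).epsMu = (MuTwoSetting.inversionModelχ p).epsMu⁻¹ := by
  change conjEpsPMχ p (inclInvχ p (SemidirectProduct.inl (gfpOf (FreeGroup.of 1)))) =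
    (inclInvχ p (SemidirectProduct.inl (gfpOf (FreeGroup.of 1))))⁻¹
  rw [conjEpsPMχ_inclInvχ, invχ, twistedInversionTop_apply, twistedInversion_inl, ← map_inv, ← map_inv]
  congr 2
  refine Subtype.ext ?_
  rw [coe_gfpInv, Subgroup.coe_inv]
  change (sigmaHat (eta (FreeGroup.of 1)), (expA (FreeGroup.of 1))⁻¹) =
    ((eta (FreeGroup.of (1 : Fin 2)), expA (FreeGroup.of 1)) : F₂hatT × Multiplicative ℤ)⁻¹
  rw [Prod.inv_mk, sigmaHat_eta, ← map_inv]
  rfl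

/-- The image of a subgroup of `Π^tp_X` under `inclX`, mapped by `Γ`, is the image of its `ι`-translate.
[cite: MochizukiEtTh2009, Prop 1.8 p.28] -/
theorem map_conjEpsPMχ_map_inclInvχ (H : Subgroup (PiTpχ p)) :
    (H.map (inclInvχ p)).map (conjEpsPMχ p).toMulEquiv.toMonoidHom =
      (H.map (invχ p).toMulEquiv.toMonoidHom).map (inclInvχ p) := by
  rw [Subgroup.map_map, Subgroup.map_map]
  congr 1
  exact MonoidHom.ext fun x => conjEpsPMχ_inclInvχ p x

/-- **`Γ` PRESERVES THE COVERINGS** `Π^tp_Ÿ`, `Π^tp_Ẍ`, `Π^tp_Ẋ`, `Π^tp_X`, `Π^tp_Ċ` of `MuTwoSetting.inversionModelχ` (with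
`ε_Z := a`): the conclusion of Prop. 1.8 for `Γ = conj ε_±`. [cite: MochizukiEtTh2009, Prop 1.8 p.28] -/
theorem preservesCoverings_conjEpsPMχ :
    PreservesCoverings (Mα := MuTwoSetting.inversionModelχ p) (Mβ := MuTwoSetting.inversionModelχ p)
      (epsZInvχ p) (epsZInvχ p) (conjEpsPMχ p) where
  map_Ydd := by
    change ((ThetaSetting.modelχ p).GtpYdd.map (inclInvχ p)).map _ = (ThetaSetting.modelχ p).GtpYdd.map (inclInvχ p)
    rw [map_conjEpsPMχ_map_inclInvχ]
    exact congrArg (Subgroup.map (inclInvχ p)) (thm16i_twistedInversion_modelχ p)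
  map_Xdd := by
    change ((Xddχ p).map (inclInvχ p)).map _ = (Xddχ p).map (inclInvχ p)
    rw [map_conjEpsPMχ_map_inclInvχ]
    congr 1
    refine map_eq_of_le_of_involutive _ (fun x => twistedInversion_twistedInversion (chi p) x) _ ?_
    rintro _ ⟨x, hx, rfl⟩
    exact (twistedInversion_mem_Xddχ_iff p x).mpr hx
  map_dotX := by
    refine map_eq_of_le_of_involutive _ (conjEpsPMχ_conjEpsPMχ p) _ ?_
    change ((Xddχ p).map (inclInvχ p) ⊔ Subgroup.zpowers (epsZInvχ p)).map _ ≤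
      (Xddχ p).map (inclInvχ p) ⊔ Subgroup.zpowers (epsZInvχ p)
    rw [Subgroup.map_sup]
    refine sup_le_sup ?_ ?_
    · rw [map_conjEpsPMχ_map_inclInvχ]
      refine Subgroup.map_mono ?_
      rintro _ ⟨x, hx, rfl⟩
      exact (twistedInversion_mem_Xddχ_iff p x).mpr hx
    · rw [MonoidHom.map_zpowers]
      change Subgroup.zpowers (conjEpsPMχ p (epsZInvχ p)) ≤ _
      rw [conjEpsPMχ_epsZInvχ, Subgroup.zpowers_inv]
  map_X := by
    refine map_eq_of_le_of_involutive _ (conjEpsPMχ_conjEpsPMχ p) _ ?_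
    rintro _ ⟨_, ⟨x, rfl⟩, rfl⟩
    exact ⟨invχ p x, (conjEpsPMχ_inclInvχ p x).symm⟩
  map_dotC := by
    refine map_eq_of_le_of_involutive _ (conjEpsPMχ_conjEpsPMχ p) _ ?_
    have hdotX : ((MuTwoSetting.inversionModelχ p).dotX (epsZInvχ p)).map (conjEpsPMχ p).toMulEquiv.toMonoidHom ≤
        (MuTwoSetting.inversionModelχ p).dotX (epsZInvχ p) := by
      change ((Xddχ p).map (inclInvχ p) ⊔ Subgroup.zpowers (epsZInvχ p)).map _ ≤
        (Xddχ p).map (inclInvχ p) ⊔ Subgroup.zpowers (epsZInvχ p)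
      rw [Subgroup.map_sup]
      refine sup_le_sup ?_ ?_
      · rw [map_conjEpsPMχ_map_inclInvχ]
        refine Subgroup.map_mono ?_
        rintro _ ⟨x, hx, rfl⟩
        exact (twistedInversion_mem_Xddχ_iff p x).mpr hx
      · rw [MonoidHom.map_zpowers]
        change Subgroup.zpowers (conjEpsPMχ p (epsZInvχ p)) ≤ _
        rw [conjEpsPMχ_epsZInvχ, Subgroup.zpowers_inv]
    change ((MuTwoSetting.inversionModelχ p).dotX (epsZInvχ p) ⊔
        Subgroup.zpowers ((MuTwoSetting.inversionModelχ p).epsPM * (MuTwoSetting.inversionModelχ p).epsMu)).map _ ≤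
      (MuTwoSetting.inversionModelχ p).dotX (epsZInvχ p) ⊔
        Subgroup.zpowers ((MuTwoSetting.inversionModelχ p).epsPM * (MuTwoSetting.inversionModelχ p).epsMu)
    rw [Subgroup.map_sup]
    refine sup_le ((hdotX.trans le_sup_left)) ?_
    rw [MonoidHom.map_zpowers, Subgroup.zpowers_le]
    -- `Γ(ε_± ε_μ) = ε_± ε_μ⁻¹ = (ε_± ε_μ) · ε_μ⁻²`, and `ε_μ² = inclX (b²) ∈ inclX(Π^tp_Ẍ) ≤ Π^tp_Ẋ`
    have hΓ : (conjEpsPMχ p).toMulEquiv.toMonoidHom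
        ((MuTwoSetting.inversionModelχ p).epsPM * (MuTwoSetting.inversionModelχ p).epsMu) =
        (MuTwoSetting.inversionModelχ p).epsPM * (MuTwoSetting.inversionModelχ p).epsMu *
          ((MuTwoSetting.inversionModelχ p).epsMu * (MuTwoSetting.inversionModelχ p).epsMu)⁻¹ := by
      change conjEpsPMχ p (epsPMInvχ p * (MuTwoSetting.inversionModelχ p).epsMu) = epsPMInvχ p * _ * _
      rw [map_mul, conjEpsPMχ_epsMu]
      change epsPMInvχ p * epsPMInvχ p * (epsPMInvχ p)⁻¹ * _ = _
      rw [epsPMInvχ_inv, epsPMInvχ_mul_self, one_mul, mul_inv_rev, ← mul_assoc, mul_inv_cancel_right]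
    rw [hΓ]
    refine Subgroup.mul_mem _ (Subgroup.mem_sup_right (Subgroup.mem_zpowers _)) (Subgroup.inv_mem _ ?_)
    refine Subgroup.mem_sup_left (Subgroup.mem_sup_left ?_)
    change inclInvχ p (SemidirectProduct.inl (gfpOf (FreeGroup.of 1))) *
        inclInvχ p (SemidirectProduct.inl (gfpOf (FreeGroup.of 1))) ∈ (Xddχ p).map (inclInvχ p)
    rw [← map_mul]
    exact ⟨_, mul_self_mem_Xddχ p _, rfl⟩

/-! ### §3. `γ`: the inner automorphism of `Π^tp_Ċ` by `ε_± · ε_μ` -/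

/-- `ε_± · ε_μ ∈ Π^tp_Ċ`. [cite: MochizukiEtTh2009, Def 1.7 p.27] -/
theorem epsPM_mul_epsMu_mem_dotC :
    (MuTwoSetting.inversionModelχ p).epsPM * (MuTwoSetting.inversionModelχ p).epsMu ∈
      (MuTwoSetting.inversionModelχ p).dotC (epsZInvχ p) :=
  Subgroup.mem_sup_right (Subgroup.mem_zpowers _)

/-- **`γ : Π^tp_Ċ ⥲ Π^tp_Ċ`, the inner automorphism by `ε_± · ε_μ`** (a topological automorphism of the subgroup
`Π^tp_Ċ ≤ Π^tp_C`). DEFINED. [cite: MochizukiEtTh2009, Thm 1.10 p.29] -/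
def gammaDotCχ : ↥((MuTwoSetting.inversionModelχ p).dotC (epsZInvχ p)) ≃ₜ*
    ↥((MuTwoSetting.inversionModelχ p).dotC (epsZInvχ p)) where
  toMulEquiv := MulAut.conj (⟨_, epsPM_mul_epsMu_mem_dotC p⟩ : ↥((MuTwoSetting.inversionModelχ p).dotC (epsZInvχ p)))
  continuous_toFun := by
    change Continuous fun x : ↥((MuTwoSetting.inversionModelχ p).dotC (epsZInvχ p)) =>
      (⟨_, epsPM_mul_epsMu_mem_dotC p⟩ : ↥((MuTwoSetting.inversionModelχ p).dotC (epsZInvχ p))) * x *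
        (⟨_, epsPM_mul_epsMu_mem_dotC p⟩ : ↥((MuTwoSetting.inversionModelχ p).dotC (epsZInvχ p)))⁻¹
    exact (continuous_const.mul continuous_id).mul continuous_const
  continuous_invFun := by
    change Continuous fun x : ↥((MuTwoSetting.inversionModelχ p).dotC (epsZInvχ p)) =>
      (⟨_, epsPM_mul_epsMu_mem_dotC p⟩ : ↥((MuTwoSetting.inversionModelχ p).dotC (epsZInvχ p)))⁻¹ * x *
        (⟨_, epsPM_mul_epsMu_mem_dotC p⟩ : ↥((MuTwoSetting.inversionModelχ p).dotC (epsZInvχ p)))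
    exact (continuous_const.mul continuous_id).mul continuous_const

/-- [cite: MochizukiEtTh2009, Thm 1.10 p.29] -/
theorem gammaDotCχ_apply_coe (x : ↥((MuTwoSetting.inversionModelχ p).dotC (epsZInvχ p))) :
    ((gammaDotCχ p x : ↥((MuTwoSetting.inversionModelχ p).dotC (epsZInvχ p))) : PiCInvχ p) =
      (MuTwoSetting.inversionModelχ p).epsPM * (MuTwoSetting.inversionModelχ p).epsMu * x *
        ((MuTwoSetting.inversionModelχ p).epsPM * (MuTwoSetting.inversionModelχ p).epsMu)⁻¹ := rfl

/-- `toZ (b) = 1`: the loop `b` has degree `0`. [cite: MochizukiEtTh2009, §1 p.12] -/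
theorem toZ_inl_gfpOf_one :
    (ThetaSetting.modelχ p).toZ (SemidirectProduct.inl (gfpOf (FreeGroup.of 1))) = 1 := by
  change Multiplicative.ofAdd (heisHom (FreeGroup.of (1 : Fin 2))).x = 1
  rw [heisHom_of_one]
  rfl

/-- **`γ` is NOT the identity** (it moves `ε_Z = a`: `(ε_±ε_μ) a (ε_±ε_μ)⁻¹ = inclX (ι(bab⁻¹))` has degree `−1 ≠ 1`).
[cite: MochizukiEtTh2009, Thm 1.10 p.29] -/
theorem gammaDotCχ_ne_refl : gammaDotCχ p ≠ ContinuousMulEquiv.refl _ := by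
  intro h
  have ha' : epsZInvχ p ∈ (MuTwoSetting.inversionModelχ p).dotX (epsZInvχ p) :=
    Subgroup.mem_sup_right (Subgroup.mem_zpowers _)
  have ha : epsZInvχ p ∈ (MuTwoSetting.inversionModelχ p).dotC (epsZInvχ p) := Subgroup.mem_sup_left ha'
  have h1 : ((gammaDotCχ p ⟨epsZInvχ p, ha⟩ : ↥((MuTwoSetting.inversionModelχ p).dotC (epsZInvχ p))) : PiCInvχ p) =
      epsZInvχ p := by
    rw [h]; rfl
  rw [gammaDotCχ_apply_coe] at h1
  -- `(ε_± ε_μ) a (ε_± ε_μ)⁻¹ = Γ (ε_μ a ε_μ⁻¹) = Γ (inclX (b a b⁻¹)) = inclX (ι (b a b⁻¹))`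
  have h2 : conjEpsPMχ p (inclInvχ p (SemidirectProduct.inl (gfpOf (FreeGroup.of 1)) *
      SemidirectProduct.inl (gfpOf (FreeGroup.of 0)) * (SemidirectProduct.inl (gfpOf (FreeGroup.of 1)))⁻¹)) =
      epsZInvχ p := by
    rw [← h1, conjEpsPMχ_apply, map_mul, map_mul, map_inv]
    change epsPMInvχ p * (_ * epsZInvχ p * _) * (epsPMInvχ p)⁻¹ =
      epsPMInvχ p * inclInvχ p (SemidirectProduct.inl (gfpOf (FreeGroup.of 1))) * epsZInvχ p *
        (epsPMInvχ p * inclInvχ p (SemidirectProduct.inl (gfpOf (FreeGroup.of 1))))⁻¹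
    group
  rw [conjEpsPMχ_inclInvχ] at h2
  have h3 := SemidirectProduct.inl_injective h2
  -- degrees: `toZ (ι x) = (toZ x)⁻¹`, `toZ a = 1 ∈ ℤ`, `toZ b = 0`
  have h4 := congrArg (ThetaSetting.modelχ p).toZ h3
  change (ThetaSetting.modelχ p).toZ (twistedInversionTop (chi p) (isInducing_leftRightχ p) _) =
    (ThetaSetting.modelχ p).toZ (SemidirectProduct.inl (gfpOf (FreeGroup.of 0))) at h4
  rw [toZ_twistedInversion_modelχ, map_mul, map_mul, map_inv, toZ_inl_gfpOf_one, toZ_inl_gfpOf_zero, one_mul,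
    inv_one, mul_one] at h4
  exact absurd h4 (by decide)

end Literature.AnabelianGeometry.EtaleTheta.SettingModel

end
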